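import Summits.MatrixMultiplication.MatrixMultiplication.Theorems.ObstructionDescentUniversalOccurrenceTwoRectangleDominoTableaux

set_option linter.dupNamespace false
set_option autoImplicit false

/-!
# Universal occurrence — two rectangles and TWO COLUMN PAIRS, part I: the `(2N-4,4)` design — alphabet, value and witness (decomp-mm · lens 3 · gen 43)

Route `route-MatrixMultiplication-ObstructionDescent` (sub-problem `MatrixMultiplication`, `ω(ℂ) = 2`); SUPPORT for the crux
`NoOccurrenceObstruction` (`P_O`, item `stmt-MatrixMultiplication-29040`) through the universal-occurrence programme (NODE-g29…g43
of the decomp-mm cell, lens 3).  Nothing here proves `ω = 2` or closes an item; no `def`, no `sorry`, standard axioms.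

**The design** (K23 floor law `occurs_unitTensor_twoRectangle_of_pairing_ne_zero`, `δ = 2`, no twist `H = ∅`): `M = e_T` for the
pair tableau `T` of `(2N-4,4)` (part H); colouring `g = (0,1,0,1,0,0,…)`; block structure `e` with core columns
`[(0,s₀),(1,s₀)] ‖ [(1,s₁),(0,s₁)]`, `[(0,s₂),(1,s₂)] ‖ [(1,s₃),(0,s₃)]`, arm `(q mod 2, ⌊q/2⌋)`.  Every term of the floor-law sum
is then `[e_T(g ∘ w_σ) ≠ 0]`, and this file shows `e_T(g ∘ w_σ) ∈ {0,1}` (`dominoPair_value_eq_one`: support ⇒ letters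
`A_i = g(σ₀ s_i)`, `B_i = g(σ₁ s_i)` with `A_i + B_i = 1`, `Σ A = Σ B = 2`, whence (`dominoPairs_local_configurations`) both pairs are
twins or both are anti-twins — an even column swap `(2 3)(6 7)` of a twin word) and exhibits the witness `σ₀ = 1`,
`σ₁ = (s₀ s₁)(s₂ s₃)` realising the row word (`dominoPair_witness`).  Part J concludes.

[cite: BurgisserIkenmeyer2011, §3.4 (Prop. 3.4), Thm. 4.4] [cite: BurgisserIkenmeyer2017, §5, Thm. 5.9 (proof of (2)), eq. (3.4)]
-/

noncomputable section

open scoped BigOperators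

namespace Summit.MatrixMultiplication.MatrixMultiplication.Theorems.ObstructionCalculus

open Literature.Computability.AlgebraicComplexity
open Literature.NumberTheory.DiophantineGeometry

/-! ### §1 Arithmetic: colour counts and the local alphabet -/

/-- A function on the slots vanishing beyond slot `3` sums to its four core values. [folklore] -/
theorem sum_core4_eq {N : ℕ} (a : Fin N → ℕ) (s0 s1 s2 s3 : Fin N) (hs0 : (s0 : ℕ) = 0) (hs1 : (s1 : ℕ) = 1)
    (hs2 : (s2 : ℕ) = 2) (hs3 : (s3 : ℕ) = 3) (h : ∀ s : Fin N, 4 ≤ (s : ℕ) → a s = 0) :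
    ∑ s, a s = a s0 + a s1 + a s2 + a s3 := by
  classical
  have hN : 4 ≤ N := by have := s3.2; omega
  let a' : ℕ → ℕ := fun n => if hn : n < N then a ⟨n, hn⟩ else 0
  have ha' : ∀ s : Fin N, a s = a' s := fun s => by simp [a']
  have h1 : ∑ s : Fin N, a s = ∑ i ∈ Finset.range N, a' i := by
    rw [← Fin.sum_univ_eq_sum_range]
    exact Finset.sum_congr rfl (fun s _ => ha' s)
  have h2 : ∑ i ∈ Finset.range 4, a' i = ∑ i ∈ Finset.range N, a' i := by
    apply Finset.sum_subset (fun x hx => Finset.mem_range.2 (lt_of_lt_of_le (Finset.mem_range.1 hx) hN))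
    intro x hx hx4
    rw [Finset.mem_range] at hx hx4
    simp only [a', dif_pos hx]
    exact h _ (by simp; omega)
  rw [h1, ← h2]
  simp only [Finset.sum_range_succ, Finset.sum_range_zero, zero_add]
  have e0 : a' 0 = a s0 := by
    simp only [a', dif_pos (show 0 < N by omega)]; congr 1; exact Fin.ext (by simp [hs0])
  have e1 : a' 1 = a s1 := by
    simp only [a', dif_pos (show 1 < N by omega)]; congr 1; exact Fin.ext (by simp [hs1])
  have e2 : a' 2 = a s2 := by
    simp only [a', dif_pos (show 2 < N by omega)]; congr 1; exact Fin.ext (by simp [hs2])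
  have e3 : a' 3 = a s3 := by
    simp only [a', dif_pos (show 3 < N by omega)]; congr 1; exact Fin.ext (by simp [hs3])
  rw [e0, e1, e2, e3]

/-- **Local configurations of the `(2N-4,4)` design.**  Letters on the core: column `0` = `(A₀,B₀)`, column `1` = `(B₁,A₁)`,
column `2` = `(A₂,B₂)`, column `3` = `(B₃,A₃)`, all `< 2`, columns `1,2,3` injective (column `0` then is), `Σ A = Σ B = 2`.  Then both pairs are twins or
both are anti-twins (the `k = 2` two-row instance of the parity law of NODE-g43 §3). [folklore] -/
theorem dominoPairs_local_configurations (A0 A1 A2 A3 B0 B1 B2 B3 : ℕ)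
    (hA0 : A0 < 2) (hB0 : B0 < 2) (hA1 : A1 < 2) (hB1 : B1 < 2) (hA2 : A2 < 2) (hB2 : B2 < 2)
    (hA3 : A3 < 2) (hB3 : B3 < 2) (c23 : B1 ≠ A1) (c45 : A2 ≠ B2) (c67 : B3 ≠ A3)
    (hsA : A0 + A1 + A2 + A3 = 2) (hsB : B0 + B1 + B2 + B3 = 2) :
    (B1 = A0 ∧ A1 = B0 ∧ B3 = A2 ∧ A3 = B2) ∨ (B1 = B0 ∧ A1 = A0 ∧ B3 = B2 ∧ A3 = A2) := by
  by_cases ht : B1 = A0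
  · left; exact ⟨ht, by omega, by omega, by omega⟩
  · right; exact ⟨by omega, by omega, by omega, by omega⟩

/-! ### §2 The value of a term -/

set_option maxHeartbeats 400000 in
/-- **A term of the `(2N-4,4)` design has `e_T(g ∘ w_σ) ∈ {0, 1}`.** [cite: BurgisserIkenmeyer2011, Thm. 4.4]
[cite: BurgisserIkenmeyer2017, Thm. 5.9 (proof of (2))] -/
theorem dominoPair_value_eq_one {N : ℕ} (hN : 4 ≤ N) {Y : YoungDiagram}
    (hNY : ∀ x ∈ Y.cells, x.1 < N) (T : StdFilling (N * 2) Y)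
    (hT : ∀ p : Fin (N * 2), T.1 p = (if (p : ℕ) < 2 then ((p : ℕ), 0) else if (p : ℕ) < 4 then ((p : ℕ) - 2, 1)
      else if (p : ℕ) < 6 then ((p : ℕ) - 4, 2) else if (p : ℕ) < 8 then ((p : ℕ) - 6, 3) else (0, (p : ℕ) - 4)))
    (e : Fin (N * 2) ≃ Fin 2 × Fin N) (g : Fin N → Fin N)
    (hgv : ∀ i : Fin N, ((g i : Fin N) : ℕ) = if ((i : ℕ) = 1 ∨ (i : ℕ) = 3) then 1 else 0)
    (hpos : ∀ (σ : Fin 2 → Equiv.Perm (Fin N)) (n : ℕ) (hn : n < N * 2) (a : Fin 2) (s : Fin N),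
      (if n = 2 then 3 else if n = 3 then 2 else if n = 6 then 7 else if n = 7 then 6 else n) % 2 = (a : ℕ) →
      (if n = 2 then 3 else if n = 3 then 2 else if n = 6 then 7 else if n = 7 then 6 else n) / 2 = (s : ℕ) →
      (g ∘ fun q => σ (e q).1 (e q).2) ⟨n, hn⟩ = g (σ a s))
    (σ : Fin 2 → Equiv.Perm (Fin N))
    (hz : T.polytabloid ℂ hNY (g ∘ fun q => σ (e q).1 (e q).2) ≠ 0) :
    T.polytabloid ℂ hNY (g ∘ fun q => σ (e q).1 (e q).2) = 1 := by
  classical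
  have hcolT : ∀ q : Fin (N * 2), (T.1 q).2 =
      if (q : ℕ) < 2 then 0 else if (q : ℕ) < 4 then 1
      else if (q : ℕ) < 6 then 2 else if (q : ℕ) < 8 then 3 else (q : ℕ) - 4 := fun q => by
    rw [hT]; split_ifs <;> rfl
  obtain ⟨s0, hs0⟩ : ∃ s : Fin N, (s : ℕ) = 0 := ⟨⟨0, by omega⟩, rfl⟩
  obtain ⟨s1, hs1⟩ : ∃ s : Fin N, (s : ℕ) = 1 := ⟨⟨1, by omega⟩, rfl⟩
  obtain ⟨s2, hs2⟩ : ∃ s : Fin N, (s : ℕ) = 2 := ⟨⟨2, by omega⟩, rfl⟩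
  obtain ⟨s3, hs3⟩ : ∃ s : Fin N, (s : ℕ) = 3 := ⟨⟨3, by omega⟩, rfl⟩
  obtain ⟨p2, hp2⟩ : ∃ p : Fin (N * 2), (p : ℕ) = 2 := ⟨⟨2, by omega⟩, rfl⟩
  obtain ⟨p3, hp3⟩ : ∃ p : Fin (N * 2), (p : ℕ) = 3 := ⟨⟨3, by omega⟩, rfl⟩
  obtain ⟨p6, hp6⟩ : ∃ p : Fin (N * 2), (p : ℕ) = 6 := ⟨⟨6, by omega⟩, rfl⟩
  obtain ⟨p7, hp7⟩ : ∃ p : Fin (N * 2), (p : ℕ) = 7 := ⟨⟨7, by omega⟩, rfl⟩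
  have hgsum : ∑ i : Fin N, ((g i : Fin N) : ℕ) = 2 := by
    rw [sum_core4_eq (fun i => ((g i : Fin N) : ℕ)) s0 s1 s2 s3 hs0 hs1 hs2 hs3
      (fun s hs => by rw [hgv]; split_ifs <;> omega)]
    simp only [hgv, hs0, hs1, hs2, hs3]
    norm_num
  obtain ⟨harm, hlt, hinj⟩ := dominoTableau_support hNY T hT hz
  have u0 := hpos σ 0 (by omega) 0 s0 (by norm_num) (by norm_num [hs0])
  have u1 := hpos σ 1 (by omega) 1 s0 (by norm_num) (by norm_num [hs0])
  have u2 := hpos σ 2 (by omega) 1 s1 (by norm_num) (by norm_num [hs1])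
  have u3 := hpos σ 3 (by omega) 0 s1 (by norm_num) (by norm_num [hs1])
  have u4 := hpos σ 4 (by omega) 0 s2 (by norm_num) (by norm_num [hs2])
  have u5 := hpos σ 5 (by omega) 1 s2 (by norm_num) (by norm_num [hs2])
  have u6 := hpos σ 6 (by omega) 1 s3 (by norm_num) (by norm_num [hs3])
  have u7 := hpos σ 7 (by omega) 0 s3 (by norm_num) (by norm_num [hs3])
  have harm0 : ∀ s : Fin N, 4 ≤ (s : ℕ) → ((g (σ 0 s) : Fin N) : ℕ) = 0 := by
    intro s hs
    have h := hpos σ (2 * s) (by omega) 0 s (by split_ifs <;> omega) (by split_ifs <;> omega)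
    rw [← h]; exact harm _ (by simp; omega)
  have harm1 : ∀ s : Fin N, 4 ≤ (s : ℕ) → ((g (σ 1 s) : Fin N) : ℕ) = 0 := by
    intro s hs
    have h := hpos σ (2 * s + 1) (by omega) 1 s (by split_ifs <;> omega) (by split_ifs <;> omega)
    rw [← h]; exact harm _ (by simp; omega)
  have hsA : ((g (σ 0 s0) : Fin N) : ℕ) + ((g (σ 0 s1) : Fin N) : ℕ) + ((g (σ 0 s2) : Fin N) : ℕ) +
      ((g (σ 0 s3) : Fin N) : ℕ) = 2 := by
    rw [← sum_core4_eq (fun s => ((g (σ 0 s) : Fin N) : ℕ)) s0 s1 s2 s3 hs0 hs1 hs2 hs3 harm0,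
      Equiv.sum_comp (σ 0) (fun x => ((g x : Fin N) : ℕ)), hgsum]
  have hsB : ((g (σ 1 s0) : Fin N) : ℕ) + ((g (σ 1 s1) : Fin N) : ℕ) + ((g (σ 1 s2) : Fin N) : ℕ) +
      ((g (σ 1 s3) : Fin N) : ℕ) = 2 := by
    rw [← sum_core4_eq (fun s => ((g (σ 1 s) : Fin N) : ℕ)) s0 s1 s2 s3 hs0 hs1 hs2 hs3 harm1,
      Equiv.sum_comp (σ 1) (fun x => ((g x : Fin N) : ℕ)), hgsum]
  -- letters and columns
  have bA0 : ((g (σ 0 s0) : Fin N) : ℕ) < 2 := by rw [← u0]; exact hlt _ (by norm_num)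
  have bB0 : ((g (σ 1 s0) : Fin N) : ℕ) < 2 := by rw [← u1]; exact hlt _ (by norm_num)
  have bB1 : ((g (σ 1 s1) : Fin N) : ℕ) < 2 := by rw [← u2]; exact hlt _ (by norm_num)
  have bA1 : ((g (σ 0 s1) : Fin N) : ℕ) < 2 := by rw [← u3]; exact hlt _ (by norm_num)
  have bA2 : ((g (σ 0 s2) : Fin N) : ℕ) < 2 := by rw [← u4]; exact hlt _ (by norm_num)
  have bB2 : ((g (σ 1 s2) : Fin N) : ℕ) < 2 := by rw [← u5]; exact hlt _ (by norm_num)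
  have bB3 : ((g (σ 1 s3) : Fin N) : ℕ) < 2 := by rw [← u6]; exact hlt _ (by norm_num)
  have bA3 : ((g (σ 0 s3) : Fin N) : ℕ) < 2 := by rw [← u7]; exact hlt _ (by norm_num)
  have cne : ∀ (i j : ℕ) (hi : i < N * 2) (hj : j < N * 2), i ≠ j → (T.1 ⟨i, hi⟩).2 = (T.1 ⟨j, hj⟩).2 →
      ∀ x y : Fin N, (g ∘ fun q => σ (e q).1 (e q).2) ⟨i, hi⟩ = x → (g ∘ fun q => σ (e q).1 (e q).2) ⟨j, hj⟩ = y →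
      ((x : Fin N) : ℕ) ≠ ((y : Fin N) : ℕ) := by
    intro i j hi hj hij hc x y hx hy hxy
    have := hinj ⟨i, hi⟩ ⟨j, hj⟩ hc (by rw [hx, hy]; exact Fin.ext hxy)
    simp only [Fin.mk.injEq] at this
    exact hij this
  have c23 := cne 2 3 (by omega) (by omega) (by norm_num) (by rw [hcolT, hcolT]; norm_num) _ _ u2 u3
  have c45 := cne 4 5 (by omega) (by omega) (by norm_num) (by rw [hcolT, hcolT]; norm_num) _ _ u4 u5
  have c67 := cne 6 7 (by omega) (by omega) (by norm_num) (by rw [hcolT, hcolT]; norm_num) _ _ u6 u7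
  have halt := dominoPairs_local_configurations _ _ _ _ _ _ _ _ bA0 bB0 bA1 bB1 bA2 bB2 bA3 bB3 c23 c45 c67
    hsA hsB
  clear c23 c45 c67 hsA hsB bA0 bB0 bA1 bB1 bB2 bA2 bA3 bB3 cne
  have hlt0 : ∀ p : Fin (N * 2), (p : ℕ) < 2 → (((g ∘ fun q => σ (e q).1 (e q).2) p : Fin N) : ℕ) < 2 :=
    fun p hp => hlt p (by omega)
  have hinj0 : ∀ p q : Fin (N * 2), (p : ℕ) < 2 → (q : ℕ) < 2 →
      (g ∘ fun q => σ (e q).1 (e q).2) p = (g ∘ fun q => σ (e q).1 (e q).2) q → p = q :=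
    fun p q hp hq hpq => hinj p q (by rw [hcolT, hcolT, if_pos hp, if_pos hq]) hpq
  have hlt2' : ∀ p : Fin (N * 2), 4 ≤ (p : ℕ) → (p : ℕ) < 6 →
      (((g ∘ fun q => σ (e q).1 (e q).2) p : Fin N) : ℕ) < 2 := fun p hp hp' => hlt p (by omega)
  have hinj2 : ∀ p q : Fin (N * 2), 4 ≤ (p : ℕ) → (p : ℕ) < 6 → 4 ≤ (q : ℕ) → (q : ℕ) < 6 →
      (g ∘ fun q => σ (e q).1 (e q).2) p = (g ∘ fun q => σ (e q).1 (e q).2) q → p = q :=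
    fun p q hp hp' hq hq' hpq => hinj p q (by
      rw [hcolT, hcolT, if_neg (by omega), if_neg (by omega), if_pos hp', if_neg (by omega), if_neg (by omega),
        if_pos hq']) hpq
  rcases halt with ⟨t2, t3, t6, t7⟩ | ⟨a2, a3, a6, a7⟩
  · -- twins
    apply dominoTableau_twin_eq_one hNY T hT (by omega) harm hlt0 hinj0 hlt2' hinj2
    · intro p hp
      obtain ⟨n, hn⟩ := p
      dsimp only at hp ⊢
      rcases (show n = 0 ∨ n = 1 by omega) with rfl | rfl
      · rw [u0]; exact u2.trans (Fin.ext t2)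
      · rw [u1]; exact u3.trans (Fin.ext t3)
    · intro p hp hp'
      obtain ⟨n, hn⟩ := p
      dsimp only at hp hp' ⊢
      rcases (show n = 4 ∨ n = 5 by omega) with rfl | rfl
      · rw [u4]; exact u6.trans (Fin.ext t6)
      · rw [u5]; exact u7.trans (Fin.ext t7)
  · -- anti-twins: an even column swap of a twin word
    rw [← dominoTableau_evenSwap hNY T hT p2 p3 p6 p7 hp2 hp3 hp6 hp7]
    set v := (g ∘ fun q => σ (e q).1 (e q).2) with hv
    set q : Equiv.Perm (Fin (N * 2)) := Equiv.swap p2 p3 * Equiv.swap p6 p7 with hq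
    have hqv : ∀ x : Fin (N * 2), ((q x : Fin (N * 2)) : ℕ) =
        if (x : ℕ) = 2 then 3 else if (x : ℕ) = 3 then 2 else if (x : ℕ) = 6 then 7 else if (x : ℕ) = 7 then 6
        else (x : ℕ) := by
      intro x
      rw [hq, Equiv.Perm.mul_apply, Equiv.swap_apply_def, Equiv.swap_apply_def]
      simp only [Fin.ext_iff, hp2, hp3, hp6, hp7]
      split_ifs <;> omega
    have hqfix : ∀ x : Fin (N * 2), (x : ℕ) ≠ 2 → (x : ℕ) ≠ 3 → (x : ℕ) ≠ 6 → (x : ℕ) ≠ 7 → q x = x := by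
      intro x h2 h3 h6 h7; apply Fin.ext; rw [hqv]; simp [h2, h3, h6, h7]
    have hq2 : q ⟨2, by omega⟩ = ⟨3, by omega⟩ := Fin.ext (by rw [hqv]; simp)
    have hq3 : q ⟨3, by omega⟩ = ⟨2, by omega⟩ := Fin.ext (by rw [hqv]; simp)
    have hq6 : q ⟨6, by omega⟩ = ⟨7, by omega⟩ := Fin.ext (by rw [hqv]; simp)
    have hq7 : q ⟨7, by omega⟩ = ⟨6, by omega⟩ := Fin.ext (by rw [hqv]; simp)
    apply dominoTableau_twin_eq_one hNY T hT (by omega)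
    · intro p hp
      show (((v (q p)) : Fin N) : ℕ) = 0
      rw [hqfix p (by omega) (by omega) (by omega) (by omega)]; exact harm p hp
    · intro p hp
      show (((v (q p)) : Fin N) : ℕ) < 2
      rw [hqfix p (by omega) (by omega) (by omega) (by omega)]; exact hlt0 p hp
    · intro p p' hp hp' hpp
      have h : v (q p) = v (q p') := hpp
      rw [hqfix p (by omega) (by omega) (by omega) (by omega),
        hqfix p' (by omega) (by omega) (by omega) (by omega)] at h
      exact hinj0 p p' hp hp' h
    · intro p hp hp'
      show (((v (q p)) : Fin N) : ℕ) < 2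
      rw [hqfix p (by omega) (by omega) (by omega) (by omega)]; exact hlt2' p hp hp'
    · intro p p' hp₁ hp₂ hp'₁ hp'₂ hpp
      have h : v (q p) = v (q p') := hpp
      rw [hqfix p (by omega) (by omega) (by omega) (by omega),
        hqfix p' (by omega) (by omega) (by omega) (by omega)] at h
      exact hinj2 p p' hp₁ hp₂ hp'₁ hp'₂ h
    · intro p hp
      show v (q _) = v (q p)
      rw [hqfix p (by omega) (by omega) (by omega) (by omega)]
      obtain ⟨n, hn⟩ := p
      dsimp only at hp ⊢
      rcases (show n = 0 ∨ n = 1 by omega) with rfl | rfl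
      · show v (q ⟨2, _⟩) = v ⟨0, _⟩
        rw [hq2, u3, u0]; exact Fin.ext a3
      · show v (q ⟨3, _⟩) = v ⟨1, _⟩
        rw [hq3, u2, u1]; exact Fin.ext a2
    · intro p hp hp'
      show v (q _) = v (q p)
      rw [hqfix p (by omega) (by omega) (by omega) (by omega)]
      obtain ⟨n, hn⟩ := p
      dsimp only at hp hp' ⊢
      rcases (show n = 4 ∨ n = 5 by omega) with rfl | rfl
      · show v (q ⟨6, _⟩) = v ⟨4, _⟩
        rw [hq6, u7, u4]; exact Fin.ext a7
      · show v (q ⟨7, _⟩) = v ⟨5, _⟩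
        rw [hq7, u6, u5]; exact Fin.ext a6

/-! ### §3 The witness term -/

set_option maxHeartbeats 400000 in
/-- **The witness.**  `σ₀ = 1`, `σ₁ = (s₀ s₁)(s₂ s₃)`: `g ∘ w_σ` is the row word of `T`, so `e_T(g ∘ w_σ) = 1 ≠ 0`. [folklore] -/
theorem dominoPair_witness {N : ℕ} (hN : 4 ≤ N) {Y : YoungDiagram}
    (hNY : ∀ x ∈ Y.cells, x.1 < N) (T : StdFilling (N * 2) Y)
    (hT : ∀ p : Fin (N * 2), T.1 p = (if (p : ℕ) < 2 then ((p : ℕ), 0) else if (p : ℕ) < 4 then ((p : ℕ) - 2, 1)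
      else if (p : ℕ) < 6 then ((p : ℕ) - 4, 2) else if (p : ℕ) < 8 then ((p : ℕ) - 6, 3) else (0, (p : ℕ) - 4)))
    (e : Fin (N * 2) ≃ Fin 2 × Fin N) (g : Fin N → Fin N)
    (hgv : ∀ i : Fin N, ((g i : Fin N) : ℕ) = if ((i : ℕ) = 1 ∨ (i : ℕ) = 3) then 1 else 0)
    (hpos : ∀ (σ : Fin 2 → Equiv.Perm (Fin N)) (n : ℕ) (hn : n < N * 2) (a : Fin 2) (s : Fin N),
      (if n = 2 then 3 else if n = 3 then 2 else if n = 6 then 7 else if n = 7 then 6 else n) % 2 = (a : ℕ) →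
      (if n = 2 then 3 else if n = 3 then 2 else if n = 6 then 7 else if n = 7 then 6 else n) / 2 = (s : ℕ) →
      (g ∘ fun q => σ (e q).1 (e q).2) ⟨n, hn⟩ = g (σ a s)) :
    ∃ σw : Fin 2 → Equiv.Perm (Fin N),
      T.polytabloid ℂ hNY (g ∘ fun q => σw (e q).1 (e q).2) ≠ 0 := by
  classical
  have hrowT : ∀ q : Fin (N * 2), (T.1 q).1 =
      if (q : ℕ) < 2 then (q : ℕ) else if (q : ℕ) < 4 then (q : ℕ) - 2
      else if (q : ℕ) < 6 then (q : ℕ) - 4 else if (q : ℕ) < 8 then (q : ℕ) - 6 else 0 := fun q => by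
    rw [hT]; split_ifs <;> rfl
  obtain ⟨s0, hs0⟩ : ∃ s : Fin N, (s : ℕ) = 0 := ⟨⟨0, by omega⟩, rfl⟩
  obtain ⟨s1, hs1⟩ : ∃ s : Fin N, (s : ℕ) = 1 := ⟨⟨1, by omega⟩, rfl⟩
  obtain ⟨s2, hs2⟩ : ∃ s : Fin N, (s : ℕ) = 2 := ⟨⟨2, by omega⟩, rfl⟩
  obtain ⟨s3, hs3⟩ : ∃ s : Fin N, (s : ℕ) = 3 := ⟨⟨3, by omega⟩, rfl⟩
  obtain ⟨σw, hw0, hw1⟩ : ∃ σw : Fin 2 → Equiv.Perm (Fin N), σw 0 = 1 ∧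
      σw 1 = Equiv.swap s0 s1 * Equiv.swap s2 s3 :=
    ⟨![1, Equiv.swap s0 s1 * Equiv.swap s2 s3], rfl, rfl⟩
  refine ⟨σw, ?_⟩
  have hsw0 : ∀ s : Fin N, ((σw 0 s : Fin N) : ℕ) = (s : ℕ) := by
    intro s; rw [hw0]; rfl
  have hsw1 : ∀ s : Fin N, ((σw 1 s : Fin N) : ℕ) =
      if (s : ℕ) = 0 then 1 else if (s : ℕ) = 1 then 0 else if (s : ℕ) = 2 then 3
      else if (s : ℕ) = 3 then 2 else (s : ℕ) := by
    intro s
    rw [hw1, Equiv.Perm.mul_apply, Equiv.swap_apply_def, Equiv.swap_apply_def]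
    simp only [Fin.ext_iff, hs0, hs1, hs2, hs3]
    split_ifs <;> omega
  -- `g ∘ w_σ = w_T`
  have hwrd : (g ∘ fun q => σw (e q).1 (e q).2) = StdFilling.rowWord hNY T := by
    funext q
    obtain ⟨n, hn⟩ := q
    apply Fin.ext
    show _ = (T.1 ⟨n, hn⟩).1
    rw [hrowT]
    dsimp only
    by_cases hn8 : n < 8
    · have hcases : n = 0 ∨ n = 1 ∨ n = 2 ∨ n = 3 ∨ n = 4 ∨ n = 5 ∨ n = 6 ∨ n = 7 := by omega
      rcases hcases with rfl | rfl | rfl | rfl | rfl | rfl | rfl | rfl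
      · rw [hpos σw 0 hn 0 s0 (by norm_num) (by norm_num [hs0]), hgv, hsw0]; simp [hs0]
      · rw [hpos σw 1 hn 1 s0 (by norm_num) (by norm_num [hs0]), hgv, hsw1]; simp [hs0]
      · rw [hpos σw 2 hn 1 s1 (by norm_num) (by norm_num [hs1]), hgv, hsw1]; simp [hs1]
      · rw [hpos σw 3 hn 0 s1 (by norm_num) (by norm_num [hs1]), hgv, hsw0]; simp [hs1]
      · rw [hpos σw 4 hn 0 s2 (by norm_num) (by norm_num [hs2]), hgv, hsw0]; simp [hs2]
      · rw [hpos σw 5 hn 1 s2 (by norm_num) (by norm_num [hs2]), hgv, hsw1]; simp [hs2]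
      · rw [hpos σw 6 hn 1 s3 (by norm_num) (by norm_num [hs3]), hgv, hsw1]; simp [hs3]
      · rw [hpos σw 7 hn 0 s3 (by norm_num) (by norm_num [hs3]), hgv, hsw0]; simp [hs3]
    · -- arm
      have ha : (if n = 2 then 3 else if n = 3 then 2 else if n = 6 then 7 else if n = 7 then 6 else n) % 2 =
          (((⟨n % 2, by omega⟩ : Fin 2) : Fin 2) : ℕ) := by
        dsimp only; split_ifs <;> omega
      have hs : (if n = 2 then 3 else if n = 3 then 2 else if n = 6 then 7 else if n = 7 then 6 else n) / 2 =
          (((⟨n / 2, by omega⟩ : Fin N) : Fin N) : ℕ) := by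
        dsimp only; split_ifs <;> omega
      rw [hpos σw n hn ⟨n % 2, by omega⟩ ⟨n / 2, by omega⟩ ha hs, hgv]
      have hfix : ((σw ⟨n % 2, by omega⟩ ⟨n / 2, by omega⟩ : Fin N) : ℕ) = n / 2 := by
        have : (⟨n % 2, by omega⟩ : Fin 2) = 0 ∨ (⟨n % 2, by omega⟩ : Fin 2) = 1 := by
          rcases Nat.mod_two_eq_zero_or_one n with h | h
          · left; exact Fin.ext h
          · right; exact Fin.ext h
        rcases this with h | h
        · rw [h, hsw0]
        · rw [h, hsw1]; dsimp only; split_ifs <;> omega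
      rw [hfix]
      split_ifs <;> omega
  rw [hwrd, StdFilling.polytabloid_apply_rowWord]
  exact one_ne_zero

end Summit.MatrixMultiplication.MatrixMultiplication.Theorems.ObstructionCalculus
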